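import Summits.AtomisticToContinuum.FouriersLaw.Theses.NoHiddenChargesKubo
import Literature.Barriers.AtomisticToContinuum.MazurBoundBallisticNarrow

/-!
# Crux `EvenChargeCompleteness` (stmt-AtomisticToContinuum-17666) — skeleton line `even-conserved-is-local`

BC3 birth skeleton filed by the crux-strategist of the parity split of `ChargeCompleteness`
(route `NoHiddenChargesKubo`). Three registered stubs and the kernel-checked composition
`EvenChargeCompleteness_of : EvenChargeCompleteness` (the three stubs invoked BY NAME inside the proof; no
other hypothesis).

* `stub_representation` (shared verbatim with the `NoOddDrudeWeight` skeleton; analytic, L-sized,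
  believed provable by the GNS / Kolmogorov dilation of the clauses): a real Hilbert space `E`, a strongly
  continuous contraction semigroup `U`, a linear isometry `R` and a class map `ι` with the dictionary
  `⟪U t (ι f), ι g⟫ = Σ_x Cov(f∘φ_t, g∘shift^x)` (`t ≥ 0`), `⟪ι f, ι g⟫ = Σ_x Cov(f, g∘shift^x)`,
  `R (ι f) = ι (f ∘ R)`, homogeneity, density of `span ι(LocObs)`.
* `stub_nondegenerate` (elementary, M-sized): every symmetric set-up carries an EVEN local polynomial
  conserved density `Q₀` with `‖Q₀‖₀² = Σ_x Cov(Q₀, Q₀∘shift^x) > 0` — the energy density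
  `e₀ = p₀²/2 + U(q₀) + V(q₁ − q₀)` (`liouvilleZ e₀ = G∘shift − G` with `G = p₀V′(q₀ − q₋₁)`; its static
  variance in a DLR Gibbs state at `T > 0` is positive, refuter estimate `≥ T²/2`).
* `stub_evenComplete` (THE CORE, open): in every such representation, for every momentum-EVEN
  `f ∈ LocObs` the hydrodynamic projection `P (ι f)` (`P` = orthogonal projection onto the conserved
  vectors of `U`, in tree `Mazur.invariantSubspace`) lies in the CLOSURE of the images `ι Q` of the EVEN
  local polynomial conserved densities `Q` — Doyon's completeness hypothesis on the even sector
  (`AmpelogiannisDoyon2026 §3.1` assume `𝒬 = span of local charges`), representation-independent thanks to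
  density + the full dictionary.
* Composition (Suzuki's equality + approximation, ≈ 90 lines): the in-tree
  `Mazur.tendsto_inv_mul_integral_inner` turns the Cesàro mean of `K_f` into `‖P ι f‖²`; if it is `0`,
  `Q₀` saturates trivially; otherwise pick even charges `Q_n` with `ι Q_n → P ι f` (`mem_closure_iff_seq_limit`),
  so that `⟨f, Q_n⟩₀²/‖Q_n‖₀² = ⟪ι f, ι Q_n⟫²/‖ι Q_n‖² → ‖P ι f‖⁴/‖P ι f‖² = ‖P ι f‖²`
  (`Mazur.inner_starProjection_self`), and some `Q_n` ε/2-saturates.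
-/

noncomputable section

namespace Summit.AtomisticToContinuum.FouriersLaw.Cruxes.EvenChargeCompleteness.EvenConservedIsLocal

open Filter Set Function MeasureTheory
open scoped Topology BigOperators InnerProductSpace
open Literature.MathematicalPhysics.KineticTheory.HeatConduction
open Summit.AtomisticToContinuum.FouriersLaw.Theses.NoHiddenChargesKubo
open Literature.Barriers.AtomisticToContinuum

/-! ## Elementary lemmas: local polynomials are local observables -/

/-- Coordinates of a box configuration are bounded by its sup norm. [folklore] -/
theorem abs_coord_le {n : ℕ} (v : Fin (n + 1) → ℝ × ℝ) (i : Fin (n + 1) × Bool) :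
    |(if i.2 then (v i.1).2 else (v i.1).1)| ≤ ‖v‖ := by
  have h1 : ‖v i.1‖ ≤ ‖v‖ := norm_le_pi_norm v i.1
  have h2 : |(v i.1).1| ≤ ‖v i.1‖ := by simpa only [Real.norm_eq_abs] using norm_fst_le (v i.1)
  have h3 : |(v i.1).2| ≤ ‖v i.1‖ := by simpa only [Real.norm_eq_abs] using norm_snd_le (v i.1)
  split_ifs <;> linarith

/-- A polynomial in the box coordinates is polynomially bounded. [folklore] -/
theorem mvPolynomial_eval_bound {n : ℕ} (w : MvPolynomial (Fin (n + 1) × Bool) ℝ) :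
    ∃ (C : ℝ) (k : ℕ), ∀ v : Fin (n + 1) → ℝ × ℝ,
      |MvPolynomial.eval (fun i : Fin (n + 1) × Bool => if i.2 then (v i.1).2 else (v i.1).1) w| ≤
        C * (1 + ‖v‖) ^ k := by
  refine MvPolynomial.induction_on
    (motive := fun w : MvPolynomial (Fin (n + 1) × Bool) ℝ => ∃ (C : ℝ) (k : ℕ),
      ∀ v : Fin (n + 1) → ℝ × ℝ,
        |MvPolynomial.eval (fun i : Fin (n + 1) × Bool => if i.2 then (v i.1).2 else (v i.1).1) w| ≤
          C * (1 + ‖v‖) ^ k) w ?_ ?_ ?_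
  · intro a
    exact ⟨|a|, 0, fun v => by simp⟩
  · rintro p q ⟨Cp, kp, hp⟩ ⟨Cq, kq, hq⟩
    refine ⟨|Cp| + |Cq|, kp + kq, fun v => ?_⟩
    have h1 : (1 : ℝ) ≤ 1 + ‖v‖ := le_add_of_nonneg_right (norm_nonneg v)
    have hkp : (1 + ‖v‖) ^ kp ≤ (1 + ‖v‖) ^ (kp + kq) :=
      pow_le_pow_right₀ h1 (Nat.le_add_right kp kq)
    have hkq : (1 + ‖v‖) ^ kq ≤ (1 + ‖v‖) ^ (kp + kq) :=
      pow_le_pow_right₀ h1 (Nat.le_add_left kq kp)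
    have hP : (0 : ℝ) ≤ (1 + ‖v‖) ^ kp := by positivity
    have hQ : (0 : ℝ) ≤ (1 + ‖v‖) ^ kq := by positivity
    have hpv := hp v
    have hqv := hq v
    have hCp : Cp * (1 + ‖v‖) ^ kp ≤ |Cp| * (1 + ‖v‖) ^ (kp + kq) :=
      (mul_le_mul_of_nonneg_right (le_abs_self Cp) hP).trans
        (mul_le_mul_of_nonneg_left hkp (abs_nonneg Cp))
    have hCq : Cq * (1 + ‖v‖) ^ kq ≤ |Cq| * (1 + ‖v‖) ^ (kp + kq) :=
      (mul_le_mul_of_nonneg_right (le_abs_self Cq) hQ).trans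
        (mul_le_mul_of_nonneg_left hkq (abs_nonneg Cq))
    rw [map_add]
    have habs := abs_add_le
      (MvPolynomial.eval (fun i : Fin (n + 1) × Bool => if i.2 then (v i.1).2 else (v i.1).1) p)
      (MvPolynomial.eval (fun i : Fin (n + 1) × Bool => if i.2 then (v i.1).2 else (v i.1).1) q)
    linarith
  · rintro p i ⟨Cp, kp, hp⟩
    refine ⟨|Cp|, kp + 1, fun v => ?_⟩
    have hP : (0 : ℝ) ≤ (1 + ‖v‖) ^ kp := by positivity
    have hx : |(if i.2 then (v i.1).2 else (v i.1).1)| ≤ 1 + ‖v‖ :=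
      (abs_coord_le v i).trans (le_add_of_nonneg_left zero_le_one)
    have hpv : |MvPolynomial.eval (fun i : Fin (n + 1) × Bool => if i.2 then (v i.1).2 else (v i.1).1) p|
        ≤ |Cp| * (1 + ‖v‖) ^ kp :=
      (hp v).trans (mul_le_mul_of_nonneg_right (le_abs_self Cp) hP)
    rw [map_mul, MvPolynomial.eval_X, abs_mul, pow_succ, ← mul_assoc]
    exact mul_le_mul hpv hx (abs_nonneg _) (by positivity)

/-- The coordinate map of a box is continuous. [folklore] -/
theorem continuous_coordMap {n : ℕ} :
    Continuous (fun v : Fin (n + 1) → ℝ × ℝ => fun i : Fin (n + 1) × Bool =>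
      if i.2 then (v i.1).2 else (v i.1).1) := by
  refine continuous_pi fun i => ?_
  obtain ⟨j, b⟩ := i
  cases b
  · simpa using (continuous_apply j).fst
  · simpa using (continuous_apply j).snd

/-- Evaluation of a polynomial in the box coordinates is continuous. [folklore] -/
theorem continuous_mvPolynomial_eval {n : ℕ} (w : MvPolynomial (Fin (n + 1) × Bool) ℝ) :
    Continuous (fun v : Fin (n + 1) → ℝ × ℝ =>
      MvPolynomial.eval (fun i : Fin (n + 1) × Bool => if i.2 then (v i.1).2 else (v i.1).1) w) :=
  (MvPolynomial.continuous_eval w).comp continuous_coordMap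

/-! ## The stubs -/

/-- stub (REPRESENTATION / GNS dictionary of a symmetric set-up; shared with the NoOddDrudeWeight
skeleton). -/
theorem stub_representation :
    ∀ ω₂ lam β γ : ℝ, 0 < ω₂ → 0 < lam → 0 < β → ∀ T : ℝ, 0 < T → ∀ μ : MeasureTheory.Measure Literature.MathematicalPhysics.KineticTheory.HeatConduction.ChainConfig, (Literature.MathematicalPhysics.KineticTheory.HeatConduction.pinnedChain ω₂ lam β γ).IsChainGibbsMeasure T μ → Literature.MathematicalPhysics.KineticTheory.HeatConduction.IsShiftInvariant μ → μ.map (fun σ : Literature.MathematicalPhysics.KineticTheory.HeatConduction.ChainConfig => fun x : ℤ => ((σ x).1, -(σ x).2)) = μ → ∀ D : Literature.MathematicalPhysics.KineticTheory.HeatConduction.InfiniteChainDynamics (Literature.MathematicalPhysics.KineticTheory.HeatConduction.pinnedChain ω₂ lam β γ), D.PreservesMeasure μ → (∀ t : ℝ, ∀ᵐ σ ∂μ, D.flow t (Literature.MathematicalPhysics.KineticTheory.HeatConduction.shift σ) = Literature.MathematicalPhysics.KineticTheory.HeatConduction.shift (D.flow t σ)) → let LocObs : (Literature.MathematicalPhysics.KineticTheory.HeatConduction.ChainConfig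 → ℝ) → Prop := fun f => ∃ (a : ℤ) (n : ℕ) (g : (Fin (n + 1) → ℝ × ℝ) → ℝ), Continuous g ∧ (∃ (C : ℝ) (k : ℕ), ∀ v, |g v| ≤ C * (1 + ‖v‖) ^ k) ∧ ∀ σ, f σ = g (Literature.MathematicalPhysics.KineticTheory.HeatConduction.boxRestrictAt a n σ); let Cov : (Literature.MathematicalPhysics.KineticTheory.HeatConduction.ChainConfig → ℝ) → (Literature.MathematicalPhysics.KineticTheory.HeatConduction.ChainConfig → ℝ) → ℝ → ℤ → ℝ := fun f g t x => MeasureTheory.integral μ (fun σ => f (D.flow t σ) * g (fun y => σ (y + x))) - MeasureTheory.integral μ (fun σ => f (D.flow t σ)) * MeasureTheory.integral μ (fun σ => g (fun y => σ (y + x))); (∀ f g : Literature.MathematicalPhysics.KineticTheory.HeatConduction.ChainConfig → ℝ, LocObs f → LocObs g → (∀ (t : ℝ) (x : ℤ), MeasureTheory.Integrable (fun σ => f (D.flow t σ) * g (fun y => σ (y + x))) μ) ∧ (∀ t₀ : ℝ, ∃ m : ℤ → ℝ, Summable m ∧ ∀ t ∈ Set.Icc (0 : ℝ) t₀, ∀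 x : ℤ, |Cov f g t x| ≤ m x) ∧ (∀ x : ℤ, Continuous (fun t : ℝ => Cov f g t x)) ∧ Continuous (fun t : ℝ => ∑' x : ℤ, Cov f g t x)) → ∃ (E : Type) (_ : NormedAddCommGroup E) (_ : InnerProductSpace ℝ E) (_ : CompleteSpace E) (U : ℝ → E →L[ℝ] E) (R : E →ₗᵢ[ℝ] E) (ι : (Literature.MathematicalPhysics.KineticTheory.HeatConduction.ChainConfig → ℝ) → E), Literature.Barriers.AtomisticToContinuum.Mazur.IsContractionSemigroup U ∧ (∀ f g : Literature.MathematicalPhysics.KineticTheory.HeatConduction.ChainConfig → ℝ, LocObs f → LocObs g → ∀ t : ℝ, 0 ≤ t → ⟪U t (ι f), ι g⟫_ℝ = ∑' x : ℤ, Cov f g t x) ∧ (∀ f g : Literature.MathematicalPhysics.KineticTheory.HeatConduction.ChainConfig → ℝ, LocObs f → LocObs g → ⟪ι f, ι g⟫_ℝ = ∑' x : ℤ, Cov f g 0 x) ∧ (∀ f : Literature.MathematicalPhysics.KineticTheory.HeatConduction.ChainConfig → ℝ, LocObs f → R (ι f) = ι (fun σ => f (fun x : ℤ => ((σ x).1,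 -(σ x).2)))) ∧ (∀ f : Literature.MathematicalPhysics.KineticTheory.HeatConduction.ChainConfig → ℝ, LocObs f → ∀ c : ℝ, ι (fun σ => c * f σ) = c • ι f) ∧ Dense ((Submodule.span ℝ (ι '' {f | LocObs f}) : Submodule ℝ E) : Set E) := by
  sorry

/-- stub (NONDEGENERACY: an even local polynomial charge with positive static variance, e₀). -/
theorem stub_nondegenerate :
    ∀ ω₂ lam β γ : ℝ, 0 < ω₂ → 0 < lam → 0 < β → ∀ T : ℝ, 0 < T → ∀ μ : MeasureTheory.Measure Literature.MathematicalPhysics.KineticTheory.HeatConduction.ChainConfig, (Literature.MathematicalPhysics.KineticTheory.HeatConduction.pinnedChain ω₂ lam β γ).IsChainGibbsMeasure T μ → Literature.MathematicalPhysics.KineticTheory.HeatConduction.IsShiftInvariant μ → μ.map (fun σ : Literature.MathematicalPhysics.KineticTheory.HeatConduction.ChainConfig => fun x : ℤ => ((σ x).1, -(σ x).2)) = μ → ∀ D : Literature.MathematicalPhysics.KineticTheory.HeatConduction.InfiniteChainDynamics (Literature.MathematicalPhysics.KineticTheory.HeatConduction.pinnedChain ω₂ lam β γ), D.PreservesMeasure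 μ → (∀ t : ℝ, ∀ᵐ σ ∂μ, D.flow t (Literature.MathematicalPhysics.KineticTheory.HeatConduction.shift σ) = Literature.MathematicalPhysics.KineticTheory.HeatConduction.shift (D.flow t σ)) → let LocPoly : (Literature.MathematicalPhysics.KineticTheory.HeatConduction.ChainConfig → ℝ) → Prop := fun f => ∃ (a : ℤ) (n : ℕ) (w : MvPolynomial (Fin (n + 1) × Bool) ℝ), ∀ σ, f σ = MvPolynomial.eval (fun v : Fin (n + 1) × Bool => if v.2 then (Literature.MathematicalPhysics.KineticTheory.HeatConduction.boxRestrictAt a n σ v.1).2 else (Literature.MathematicalPhysics.KineticTheory.HeatConduction.boxRestrictAt a n σ v.1).1) w; let LocObs : (Literature.MathematicalPhysics.KineticTheory.HeatConduction.ChainConfig → ℝ) → Prop := fun f => ∃ (a : ℤ) (n : ℕ) (g : (Fin (n + 1) → ℝ × ℝ) → ℝ), Continuous g ∧ (∃ (C : ℝ) (k : ℕ), ∀ v, |g v| ≤ C * (1 + ‖v‖) ^ k) ∧ ∀ σ, f σ = g (Literature.MathematicalPhysics.KineticTheory.HeatConduction.boxRestrictAt a n σ); let Cons : (Literature.MathematicalPhysics.KineticTheory.HeatConduction.ChainConfig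 → ℝ) → Prop := fun Q => ∃ G : Literature.MathematicalPhysics.KineticTheory.HeatConduction.ChainConfig → ℝ, LocPoly G ∧ ∀ σ, Literature.MathematicalPhysics.KineticTheory.HeatConduction.liouvilleZ (Literature.MathematicalPhysics.KineticTheory.HeatConduction.pinnedChain ω₂ lam β γ) Q σ = G (Literature.MathematicalPhysics.KineticTheory.HeatConduction.shift σ) - G σ; let Cov : (Literature.MathematicalPhysics.KineticTheory.HeatConduction.ChainConfig → ℝ) → (Literature.MathematicalPhysics.KineticTheory.HeatConduction.ChainConfig → ℝ) → ℝ → ℤ → ℝ := fun f g t x => MeasureTheory.integral μ (fun σ => f (D.flow t σ) * g (fun y => σ (y + x))) - MeasureTheory.integral μ (fun σ => f (D.flow t σ)) * MeasureTheory.integral μ (fun σ => g (fun y => σ (y + x))); (∀ f g : Literature.MathematicalPhysics.KineticTheory.HeatConduction.ChainConfig → ℝ, LocObs f → LocObs g → (∀ (t : ℝ) (x : ℤ), MeasureTheory.Integrable (fun σ => f (D.flow t σ) * g (fun y => σ (y + x))) μ) ∧ (∀ t₀ : ℝ, ∃ m : ℤ → ℝ, Summable m ∧ ∀ t ∈ Set.Icc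 (0 : ℝ) t₀, ∀ x : ℤ, |Cov f g t x| ≤ m x) ∧ (∀ x : ℤ, Continuous (fun t : ℝ => Cov f g t x)) ∧ Continuous (fun t : ℝ => ∑' x : ℤ, Cov f g t x)) → ∃ Q : Literature.MathematicalPhysics.KineticTheory.HeatConduction.ChainConfig → ℝ, LocPoly Q ∧ Cons Q ∧ (∀ σ, Q (fun x : ℤ => ((σ x).1, -(σ x).2)) = Q σ) ∧ 0 < ∑' x : ℤ, Cov Q Q 0 x := by
  sorry

/-- stub (THE CORE: on the even sector the conserved space is the closure of the even local charges). -/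
theorem stub_evenComplete :
    ∀ ω₂ lam β γ : ℝ, 0 < ω₂ → 0 < lam → 0 < β → ∀ T : ℝ, 0 < T → ∀ μ : MeasureTheory.Measure Literature.MathematicalPhysics.KineticTheory.HeatConduction.ChainConfig, (Literature.MathematicalPhysics.KineticTheory.HeatConduction.pinnedChain ω₂ lam β γ).IsChainGibbsMeasure T μ → Literature.MathematicalPhysics.KineticTheory.HeatConduction.IsShiftInvariant μ → μ.map (fun σ : Literature.MathematicalPhysics.KineticTheory.HeatConduction.ChainConfig => fun x : ℤ => ((σ x).1, -(σ x).2)) = μ → ∀ D : Literature.MathematicalPhysics.KineticTheory.HeatConduction.InfiniteChainDynamics (Literature.MathematicalPhysics.KineticTheory.HeatConduction.pinnedChain ω₂ lam β γ), D.PreservesMeasure μ → (∀ t : ℝ, ∀ᵐ σ ∂μ, D.flow t (Literature.MathematicalPhysics.KineticTheory.HeatConduction.shift σ) = Literature.MathematicalPhysics.KineticTheory.HeatConduction.shift (D.flow t σ)) → let LocPoly : (Literature.MathematicalPhysics.KineticTheory.HeatConduction.ChainConfig → ℝ) → Prop := fun f => ∃ (a : ℤ) (n : ℕ) (w : MvPolynomial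 (Fin (n + 1) × Bool) ℝ), ∀ σ, f σ = MvPolynomial.eval (fun v : Fin (n + 1) × Bool => if v.2 then (Literature.MathematicalPhysics.KineticTheory.HeatConduction.boxRestrictAt a n σ v.1).2 else (Literature.MathematicalPhysics.KineticTheory.HeatConduction.boxRestrictAt a n σ v.1).1) w; let LocObs : (Literature.MathematicalPhysics.KineticTheory.HeatConduction.ChainConfig → ℝ) → Prop := fun f => ∃ (a : ℤ) (n : ℕ) (g : (Fin (n + 1) → ℝ × ℝ) → ℝ), Continuous g ∧ (∃ (C : ℝ) (k : ℕ), ∀ v, |g v| ≤ C * (1 + ‖v‖) ^ k) ∧ ∀ σ, f σ = g (Literature.MathematicalPhysics.KineticTheory.HeatConduction.boxRestrictAt a n σ); let Cons : (Literature.MathematicalPhysics.KineticTheory.HeatConduction.ChainConfig → ℝ) → Prop := fun Q => ∃ G : Literature.MathematicalPhysics.KineticTheory.HeatConduction.ChainConfig → ℝ, LocPoly G ∧ ∀ σ, Literature.MathematicalPhysics.KineticTheory.HeatConduction.liouvilleZ (Literature.MathematicalPhysics.KineticTheory.HeatConduction.pinnedChain ω₂ lam β γ) Q σ = G (Literature.MathematicalPhysics.KineticTheory.HeatConduction.shift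 σ) - G σ; let Cov : (Literature.MathematicalPhysics.KineticTheory.HeatConduction.ChainConfig → ℝ) → (Literature.MathematicalPhysics.KineticTheory.HeatConduction.ChainConfig → ℝ) → ℝ → ℤ → ℝ := fun f g t x => MeasureTheory.integral μ (fun σ => f (D.flow t σ) * g (fun y => σ (y + x))) - MeasureTheory.integral μ (fun σ => f (D.flow t σ)) * MeasureTheory.integral μ (fun σ => g (fun y => σ (y + x))); (∀ f g : Literature.MathematicalPhysics.KineticTheory.HeatConduction.ChainConfig → ℝ, LocObs f → LocObs g → (∀ (t : ℝ) (x : ℤ), MeasureTheory.Integrable (fun σ => f (D.flow t σ) * g (fun y => σ (y + x))) μ) ∧ (∀ t₀ : ℝ, ∃ m : ℤ → ℝ, Summable m ∧ ∀ t ∈ Set.Icc (0 : ℝ) t₀, ∀ x : ℤ, |Cov f g t x| ≤ m x) ∧ (∀ x : ℤ, Continuous (fun t : ℝ => Cov f g t x)) ∧ Continuous (fun t : ℝ => ∑' x : ℤ, Cov f g t x)) → ∀ (E : Type) [NormedAddCommGroup E] [InnerProductSpace ℝ E] [CompleteSpace E] (U : ℝ → E →L[ℝ] E) (R : E →ₗᵢ[ℝ]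 E) (ι : (Literature.MathematicalPhysics.KineticTheory.HeatConduction.ChainConfig → ℝ) → E), Literature.Barriers.AtomisticToContinuum.Mazur.IsContractionSemigroup U → (∀ f g : Literature.MathematicalPhysics.KineticTheory.HeatConduction.ChainConfig → ℝ, LocObs f → LocObs g → ∀ t : ℝ, 0 ≤ t → ⟪U t (ι f), ι g⟫_ℝ = ∑' x : ℤ, Cov f g t x) → (∀ f g : Literature.MathematicalPhysics.KineticTheory.HeatConduction.ChainConfig → ℝ, LocObs f → LocObs g → ⟪ι f, ι g⟫_ℝ = ∑' x : ℤ, Cov f g 0 x) → (∀ f : Literature.MathematicalPhysics.KineticTheory.HeatConduction.ChainConfig → ℝ, LocObs f → R (ι f) = ι (fun σ => f (fun x : ℤ => ((σ x).1, -(σ x).2)))) → (∀ f : Literature.MathematicalPhysics.KineticTheory.HeatConduction.ChainConfig → ℝ, LocObs f → ∀ c : ℝ, ι (fun σ => c * f σ) = c • ι f) → Dense ((Submodule.span ℝ (ι '' {f | LocObs f}) : Submodule ℝ E) : Set E) → ∀ f : Literature.MathematicalPhysics.KineticTheory.HeatConduction.ChainConfig → ℝ, LocObs f → (∀ σ, f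 (fun x : ℤ => ((σ x).1, -(σ x).2)) = f σ) → (Literature.Barriers.AtomisticToContinuum.Mazur.invariantSubspace U).starProjection (ι f) ∈ closure (ι '' {Q | LocPoly Q ∧ Cons Q ∧ ∀ σ, Q (fun x : ℤ => ((σ x).1, -(σ x).2)) = Q σ}) := by
  sorry

/-! ## The composition -/

/-- **Composition**: representation + nondegeneracy + even completeness ⇒ `EvenChargeCompleteness`,
via Suzuki's equality (`Mazur.tendsto_inv_mul_integral_inner`) and approximation of the hydrodynamic
projection by images of even local charges. [folklore] -/
theorem EvenChargeCompleteness_of : EvenChargeCompleteness := by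
  have hRep := stub_representation
  have hND := stub_nondegenerate
  have hEC := stub_evenComplete
  intro ω₂ lam β γ hω hl hβ T hT μ hμG hμS hμR D hD hcomm LocPoly LocObs Cons Cov hcl f hf heven ε hε
  obtain ⟨E, i1, i2, i3, U, R, ι, hU, hdyn, hstat, hR, hlin, hdense⟩ :=
    hRep ω₂ lam β γ hω hl hβ T hT μ hμG hμS hμR D hD hcomm hcl
  obtain ⟨Q₀, hQ₀P, hQ₀C, hQ₀e, hQ₀pos⟩ := hND ω₂ lam β γ hω hl hβ T hT μ hμG hμS hμR D hD hcomm hcl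
  have hmem : (Mazur.invariantSubspace U).starProjection (ι f) ∈
      closure (ι '' {Q | LocPoly Q ∧ Cons Q ∧ ∀ σ, Q (fun x : ℤ => ((σ x).1, -(σ x).2)) = Q σ}) :=
    hEC ω₂ lam β γ hω hl hβ T hT μ hμG hμS hμR D hD hcomm hcl E U R ι hU hdyn hstat hR hlin hdense
      f hf heven
  -- local polynomials are local observables
  have hpoly : ∀ Q : ChainConfig → ℝ, LocPoly Q → LocObs Q := by
    rintro Q ⟨a', n', w, hw⟩
    obtain ⟨C', k', hC'⟩ := mvPolynomial_eval_bound w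
    exact ⟨a', n', fun v => MvPolynomial.eval
      (fun i : Fin (n' + 1) × Bool => if i.2 then (v i.1).2 else (v i.1).1) w,
      continuous_mvPolynomial_eval w, ⟨C', k', hC'⟩, fun σ => hw σ⟩
  -- Suzuki: the Cesàro mean of K_f tends to ‖P ι f‖²
  have hK : Tendsto (fun τ : ℝ => τ⁻¹ * ∫ t in (0:ℝ)..τ, ∑' x : ℤ, Cov f f t x) atTop
      (𝓝 (‖(Mazur.invariantSubspace U).starProjection (ι f)‖ ^ 2)) := by
    refine (Mazur.tendsto_inv_mul_integral_inner hU (ι f)).congr' ?_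
    filter_upwards [eventually_ge_atTop (0 : ℝ)] with τ hτ
    congr 1
    apply intervalIntegral.integral_congr
    intro t ht
    rw [Set.uIcc_of_le hτ] at ht
    exact hdyn f f hf hf t ht.1
  set v : E := (Mazur.invariantSubspace U).starProjection (ι f) with hv
  by_cases hv0 : v = 0
  · -- zero Drude weight: the energy density saturates trivially
    refine ⟨Q₀, hQ₀P, hQ₀C, hQ₀e, hQ₀pos, ?_⟩
    have hK0 : Tendsto (fun τ : ℝ => τ⁻¹ * ∫ t in (0:ℝ)..τ, ∑' x : ℤ, Cov f f t x) atTop (𝓝 0) := by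
      rw [hv0, norm_zero, zero_pow two_ne_zero] at hK
      exact hK
    have hnonneg : 0 ≤ (∑' x : ℤ, Cov f Q₀ 0 x) ^ 2 / (∑' x : ℤ, Cov Q₀ Q₀ 0 x) :=
      div_nonneg (sq_nonneg _) hQ₀pos.le
    have hlt : (0 : ℝ) < (∑' x : ℤ, Cov f Q₀ 0 x) ^ 2 / (∑' x : ℤ, Cov Q₀ Q₀ 0 x) + ε := by
      linarith
    exact (hK0.eventually_lt_const hlt).mono fun τ h => h.le
  · -- positive Drude weight: approximate v by images of even local charges
    obtain ⟨w, hw_mem, hw_lim⟩ := mem_closure_iff_seq_limit.1 hmem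
    choose Qn hQn hQn_eq using hw_mem
    have h_iv : ⟪ι f, v⟫_ℝ = ‖v‖ ^ 2 := Mazur.inner_starProjection_self _ (ι f)
    have h_inner : Tendsto (fun n => ⟪ι f, w n⟫_ℝ) atTop (𝓝 (‖v‖ ^ 2)) := by
      rw [← h_iv]
      exact tendsto_const_nhds.inner hw_lim
    have h_norm : Tendsto (fun n => ‖w n‖ ^ 2) atTop (𝓝 (‖v‖ ^ 2)) := (hw_lim.norm).pow 2
    have hvpos : 0 < ‖v‖ := norm_pos_iff.2 hv0
    have hv2 : 0 < ‖v‖ ^ 2 := by positivity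
    have h_ratio : Tendsto (fun n => ⟪ι f, w n⟫_ℝ ^ 2 / ‖w n‖ ^ 2) atTop
        (𝓝 ((‖v‖ ^ 2) ^ 2 / ‖v‖ ^ 2)) :=
      (h_inner.pow 2).div h_norm hv2.ne'
    have h_val : (‖v‖ ^ 2) ^ 2 / ‖v‖ ^ 2 = ‖v‖ ^ 2 := by
      field_simp
    rw [h_val] at h_ratio
    have hev1 : ∀ᶠ n in atTop, ‖v‖ ^ 2 - ε / 2 < ⟪ι f, w n⟫_ℝ ^ 2 / ‖w n‖ ^ 2 :=
      h_ratio.eventually_const_lt (by linarith)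
    have hev2 : ∀ᶠ n in atTop, 0 < ‖w n‖ ^ 2 := h_norm.eventually_const_lt hv2
    obtain ⟨n, hn1, hn2⟩ := (hev1.and hev2).exists
    obtain ⟨hPn, hCn, hEn⟩ := hQn n
    have hQobs : LocObs (Qn n) := hpoly (Qn n) hPn
    have hstatQ : ⟪ι (Qn n), ι (Qn n)⟫_ℝ = ∑' x : ℤ, Cov (Qn n) (Qn n) 0 x :=
      hstat (Qn n) (Qn n) hQobs hQobs
    have hstatfQ : ⟪ι f, ι (Qn n)⟫_ℝ = ∑' x : ℤ, Cov f (Qn n) 0 x := hstat f (Qn n) hf hQobs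
    have hnormQ : ∑' x : ℤ, Cov (Qn n) (Qn n) 0 x = ‖w n‖ ^ 2 := by
      rw [← hstatQ, hQn_eq n, real_inner_self_eq_norm_sq]
    have hinnerQ : ∑' x : ℤ, Cov f (Qn n) 0 x = ⟪ι f, w n⟫_ℝ := by
      rw [← hstatfQ, hQn_eq n]
    refine ⟨Qn n, hPn, hCn, hEn, ?_, ?_⟩
    · rw [hnormQ]
      exact hn2
    · have hbound : ‖v‖ ^ 2 <
          (∑' x : ℤ, Cov f (Qn n) 0 x) ^ 2 / (∑' x : ℤ, Cov (Qn n) (Qn n) 0 x) + ε := by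
        rw [hnormQ, hinnerQ]
        linarith
      exact (hK.eventually_lt_const hbound).mono fun τ h => h.le

end Summit.AtomisticToContinuum.FouriersLaw.Cruxes.EvenChargeCompleteness.EvenConservedIsLocal

end
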